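import Summits.Ventures.PercRepro.RankLevelSetLevelSixT22AssemblyTwo
import Summits.Ventures.PercRepro.RankLevelSetLevelSixT22Free11Le21Span
import Summits.Ventures.PercRepro.RankLevelSetLevelSixT22Free11Le22Span
import Summits.Ventures.PercRepro.RankLevelSetLevelSixT22Free12Le23Span
import Summits.Ventures.PercRepro.RankLevelSetLevelSixT22Free12Le24Span

/-!
# PercRepro — THE CORE CELL `(22, 11)` IS A THEOREM; THE 22 ROW MODULO ONE MANY-TRIANGLE STATEMENT (p8 g14, S3)

The spanning tail cut by the triangles (RankLevelSetSpanningTriangles, the cell `sq27di2v_span`) closes the branches the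
crude tail could not: at `(22, 11)` the branch `s₃ = 21` with two triangles (`c025_core_six_t22_free11_le21_span`) and
`s₃ = 22` — the triangle cap of the coloop-free step — with three (`…_le22_span`), so the coloop-free cell `(22, 11)` is
UNCONDITIONAL (`c025_core_six_t22_free11`) and with the coloop device **the core cell `(22, 11)` is a theorem**
(`c025_core_six_twentytwo_11`). At `(22, 12)` the branches `s₃ ≤ 23` (two triangles) and `s₃ = 24` (three) close;
the 22 row — and C-025 at level `6` for every `p ≥ 22` — is a theorem modulo ONE statement: coloop-free `e`-free cores of
rank `22` with `34` points and `≥ 25` triangles (`c025_six_large_twenty_two_of_one`). Axioms: standard.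
-/

open scoped Matroid

namespace PercRepro

namespace ThmN

variable {α : Type}

/-- **THE COLOOP-FREE CELL `(22, 11)`, UNCONDITIONAL**: `s₃ ≤ 20` on the crude tail, `s₃ = 21` with two triangles,
`s₃ = 22` (the cap) with three. -/
theorem c025_core_six_t22_free11 (N : Matroid α) [N.Finite] (hcf : ∀ e ∈ N.E, ¬ N.IsColoop e)
    (hRN : N.eRank = (22 : ℕ∞)) (hnN : N.E.ncard = 22 + 11)
    (hfreeN : ∀ e ∈ N.E, ∃ A ⊆ N.E \ {e}, e ∉ N.closure A ∧ e ∉ N.closure ((N.E \ {e}) \ A)) : RLS N 22 6 := by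
  have hd : N.E.encard = N.eRank + (11 : ℕ) := by
    rw [hRN, ← N.ground_finite.cast_ncard_eq, hnN]
    push_cast
    ring
  have hcap : {C : Set α | N.IsCircuit C ∧ C.ncard = 3}.ncard ≤ 22 :=
    s3_cf_of N hfreeN hcf (d := 10) (by simpa using hd) 33 22 (by norm_num) (by omega) (by decide) (by decide) (by decide)
  by_cases h20 : {C : Set α | N.IsCircuit C ∧ C.ncard = 3}.ncard ≤ 20
  · exact c025_core_six_t22_free11_le20 N 22 le_rfl hcf h20 hRN hnN hfreeN
  by_cases h21 : {C : Set α | N.IsCircuit C ∧ C.ncard = 3}.ncard ≤ 21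
  · exact c025_core_six_t22_free11_le21_span N hcf h21 (by omega) hRN hnN hfreeN
  · exact c025_core_six_t22_free11_le22_span N hcf hcap (by omega) hRN hnN hfreeN

/-- **THE CORE CELL `(22, 11)` IS A THEOREM** (the coloop device on the unconditional coloop-free cell). -/
theorem c025_core_six_twentytwo_11 (M : Matroid α) [M.Finite]
    (hR : M.eRank = (22 : ℕ∞)) (hn : M.E.ncard = 22 + 11)
    (hfree : ∀ e ∈ M.E, ∃ A ⊆ M.E \ {e}, e ∉ M.closure A ∧ e ∉ M.closure ((M.E \ {e}) \ A)) : RLS M 22 6 :=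
  c025_core_six_twentytwo_11_of_free M hR hn hfree
    (fun N _ hcf hRN hnN hfreeN => c025_core_six_t22_free11 N hcf hRN hnN hfreeN)

/-- **The coloop-free cell `(22, 12)` modulo its branch `s₃ ≥ 25`**: `s₃ ≤ 21` on the crude tail, `s₃ ≤ 23` with two
triangles, `s₃ = 24` with three. -/
theorem c025_core_six_t22_free12_of_many25 (N : Matroid α) [N.Finite] (hcf : ∀ e ∈ N.E, ¬ N.IsColoop e)
    (hRN : N.eRank = (22 : ℕ∞)) (hnN : N.E.ncard = 22 + 12)
    (hfreeN : ∀ e ∈ N.E, ∃ A ⊆ N.E \ {e}, e ∉ N.closure A ∧ e ∉ N.closure ((N.E \ {e}) \ A))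
    (h25 : 25 ≤ {C : Set α | N.IsCircuit C ∧ C.ncard = 3}.ncard → RLS N 22 6) : RLS N 22 6 := by
  by_cases h21 : {C : Set α | N.IsCircuit C ∧ C.ncard = 3}.ncard ≤ 21
  · exact c025_core_six_t22_free12_le21 N 22 le_rfl hcf h21 hRN hnN hfreeN
  by_cases h23 : {C : Set α | N.IsCircuit C ∧ C.ncard = 3}.ncard ≤ 23
  · exact c025_core_six_t22_free12_le23_span N hcf h23 (by omega) hRN hnN hfreeN
  by_cases h24 : {C : Set α | N.IsCircuit C ∧ C.ncard = 3}.ncard ≤ 24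
  · exact c025_core_six_t22_free12_le24_span N hcf h24 (by omega) hRN hnN hfreeN
  · exact h25 (by omega)

/-- **The cell `(22, 12)` modulo the branch `s₃ ≥ 25` of its coloop-free cell.** -/
theorem c025_core_six_twentytwo_12_of_many25 (M : Matroid α) [M.Finite]
    (hR : M.eRank = (22 : ℕ∞)) (hn : M.E.ncard = 22 + 12)
    (hfree : ∀ e ∈ M.E, ∃ A ⊆ M.E \ {e}, e ∉ M.closure A ∧ e ∉ M.closure ((M.E \ {e}) \ A))
    (h25 : ∀ N : Matroid α, ∀ [N.Finite], (∀ e ∈ N.E, ¬ N.IsColoop e) → N.eRank = (22 : ℕ∞) → N.E.ncard = 22 + 12 →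
      (∀ e ∈ N.E, ∃ A ⊆ N.E \ {e}, e ∉ N.closure A ∧ e ∉ N.closure ((N.E \ {e}) \ A)) →
      25 ≤ {C : Set α | N.IsCircuit C ∧ C.ncard = 3}.ncard → RLS N 22 6) : RLS M 22 6 :=
  c025_core_six_twentytwo_12_of_free M hR hn hfree
    (fun N _ hcf hRN hnN hfreeN => c025_core_six_t22_free12_of_many25 N hcf hRN hnN hfreeN (h25 N hcf hRN hnN hfreeN))
    (fun N _ hcf hRN hnN hfreeN => c025_core_six_t22_scaled1_cf12 N hcf hRN hnN hfreeN)

/-- **C-025 AT LEVEL `6` FOR EVERY `p ≥ 22` MODULO ONE MANY-TRIANGLE STATEMENT** — coloop-free `e`-free cores of rank `22`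
with `34` points and at least `25` triangles (the cap being `26`). -/
theorem c025_six_large_twenty_two_of_one
    (h12 : ∀ N : Matroid α, ∀ [N.Finite], (∀ e ∈ N.E, ¬ N.IsColoop e) → N.eRank = (22 : ℕ∞) → N.E.ncard = 22 + 12 →
      (∀ e ∈ N.E, ∃ A ⊆ N.E \ {e}, e ∉ N.closure A ∧ e ∉ N.closure ((N.E \ {e}) \ A)) →
      25 ≤ {C : Set α | N.IsCircuit C ∧ C.ncard = 3}.ncard → RLS N 22 6)
    (M : Matroid α) [M.Finite] (p : ℕ) (hp : 22 ≤ p) : RLS M p 6 :=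
  c025_six_large_twenty_two_of
    (fun N _ hRN hnN hfreeN => c025_core_six_twentytwo_11 N hRN hnN hfreeN)
    (fun N _ hRN hnN hfreeN => c025_core_six_twentytwo_12_of_many25 N hRN hnN hfreeN h12) M p hp

end ThmN

end PercRepro
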